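import Literature.AlgebraicGeometry.Motives.AbsolutelyTateClasses
import Literature.AlgebraicGeometry.Motives.CrystallineTateClasses
import Summits.HodgeConjecture.HodgeConjecture.Theorems.PadicSemiregularLiftHodgeAbelianVarietiesStarSeedsEngine

/-!
# Crux `HodgeBeyondAnchors` (stmt-HodgeConjecture-14054), line `Sketch` (card `fixed-part-frobenius-frame`):
# fixed-part functoriality and the FRAME-TO-ENGINE glue (helper file, `--supports`)

Route `PadicSemiregularLift` of `HodgeConjecture`. The crux `HodgeBeyondAnchors` is, as typed, the Hodge
conjecture off the two anchor classes and is equivalent to the whole summit (`…Reductions`,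
`…Equivalence`). The round-1 crux idea card `Cruxes/HodgeBeyondAnchors/Ideas/fixed-part-frobenius-frame.md`
(ideator 2) proposes to replace the route's named input P4 `OgusCrystallineTate` ("the de Rham component of
the Hodge class is crystalline Tate ON THE NOSE", `CrystallineRealization.IsTateAtModel`) by a FRAME
statement: on a pure positive-dimensional Hodge-locus component the FIXED PART
`I = im(H²ʳ(𝒴) → H²ʳ(𝒳))` (total space → fibre) is Frobenius-stable by functoriality alone and — by weak
admissibility + Hodge–Riemann + Dieudonné–Manin, none of which the tree's hypothesis structures carry —
spanned over `K = W(k)[1/p]` by Tate classes. This file lands, sorry-free and over the TREE's vocabulary only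
(`CrystallineFrobeniusDatum`, `CrystallineRealization`, `WittScheme.*`), the part of that line that is
checkable today:

* §1 (number-field / linear-Frobenius form, `CrystallineFrobeniusDatum D v L`): `range_pullback_phi_stable`
  (the image of `f^*` is `φ_v`-stable), `phi_pow_pullback`, `pivot_transfer` (if `φ_v^N = c` on a pivot fibre
  killing the same classes, then `φ_v^N = c` on the fixed part), `phi_pow_tmul_of_mem_algebraicClasses`
  (algebraic classes are Tate on the nose) — adapted from the ideator's `IdeatorTwoSketch.lean`;
* §2 (model / semilinear form, `CrystallineRealization p k`): `bo_chCris_pullback_mem_range` (relative seeds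
  have fixed-part Chern characters), `frobK_mem_range_pullback` (the crystalline fixed part is `φ`-stable),
  `frobK_mem_span_tateClasses` (the `K`-span of the Tate classes is `φ`-stable);
* §3 THE GLUE the card needs and the route lacked: `bo_mem_span_ratAlgebraicClasses_of_frame` — at a model
  `h : 𝒳 ⟶ 𝒴` of smooth proper `W(k)`-schemes, IF the crystalline fixed part `im((h mod p)^*)` lies in the
  `K`-span of the Tate classes of `X_k` (the frame, pointwise instance of the card's `FixedPartTateFrame`) AND
  every Tate class of `X_k` has Berthelot–Ogus image in the `K`-span of the algebraic classes of `X_K` (what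
  seeds + engine deliver class by class), THEN every de Rham fixed-part class `α ∈ im(h_K^*) ⊆ H²ʳ_dR(X_K/K)` is
  a `K`-combination of algebraic classes — with NO Tateness of `α` itself (P4) required; the P4 special case
  `mem_span_ratAlgebraicClasses_of_isTateAtModel`; and the composition with the landed engine
  (`…StarSeedsEngine.bo_mem_span_of_starSeedClasses`: (⋆)-seeds + BEK + P1a + P3a, the route items taken BY
  NAME, hence conditional on them by design): `bo_mem_span_ratAlgebraicClasses_of_frame_of_starSeeds`.

Nothing here restates the crux, a stub, or a published theorem as a fact; the frame and the seed supply enter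
only as LOCAL hypotheses of the glue lemmas (the card's named `Prop`s `FixedPartTateFrame`,
`RankOneNewFixedPartTate` are predicates on abstract realization data and are deliberately not declared here).
What is NOT here (and why the line cannot close the crux as typed): the comparison of a complex variety with a
`W(k)`-model (no classical value of `CrystallineRealization` exists in the tree), genuineness at finite level,
seed EXISTENCE at free smooth points (open), and the card's residue `RIG` (HC for rigid pairs) — see
`Cruxes/HodgeBeyondAnchors/Lines/Sketch.dead.md`.

References: P. Berthelot, A. Ogus, *F-isocrystals and de Rham cohomology I*, Invent. Math. 72 (1983), Thm. 2.4,
(2.4.5), Cor. 2.5, Thm. 4.2; A. Ogus, *Hodge cycles and crystalline cohomology*, LNM 900 (1982), §4 (4.1.2);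
S. Bloch, H. Esnault, M. Kerz, Invent. Math. 195 (2014), Thm. 1.3; card `Ideas/fixed-part-frobenius-frame.md`.
-/

-- `Summit.HodgeConjecture.HodgeConjecture.…` is the tree's mandated summit/problem namespace (single-problem summit):
-- the duplicated component is by design (CONVENTIONS §1), so the dupNamespace linter is silenced for this file.
set_option linter.dupNamespace false

noncomputable section

open CategoryTheory AlgebraicGeometry IsDedekindDomain
open scoped TensorProduct NumberField Isocrystal
open Literature.AlgebraicGeometry Literature.AlgebraicGeometry.Motives
  Literature.AlgebraicGeometry.Crystalline Literature.AlgebraicGeometry.KTheory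

namespace Summit.HodgeConjecture.HodgeConjecture.Theorems.HodgeBeyondAnchors.FixedPartFrame

/-! ## §1 Number-field / linear-Frobenius form (`CrystallineFrobeniusDatum`) -/

section NumberField

variable {k : Type} [Field k] [NumberField k] {D : DeRhamRealization k}
  {v : HeightOneSpectrum (𝓞 k)} {L : Type} [Field L] [Algebra k L]
  (Φ : CrystallineFrobeniusDatum D v L)

-- §1 is adapted from `Cruxes/HodgeBeyondAnchors/IdeatorTwoSketch.lean` (planner-cruxidea-…-14054-2-0).

/-- **Fixed-part Frobenius stability.** For a `k`-morphism `f : X ⟶ Y` of smooth projective varieties, both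
with good reduction at `v`, the image of `f^* ⊗ L : H^i_dR(Y/k) ⊗ L → H^i_dR(X/k) ⊗ L` is stable under the
linear crystalline Frobenius `φ_v` of `X` (naturality `phi_pullback`). With `Y` a smooth projective
compactification of the total space of a family and `X` a fibre, the image is the FIXED PART, which is thus
`φ_v`-stable by functoriality alone. [cite: BerthelotOgus1983, Thm. 4.2] -/
theorem range_pullback_phi_stable {n m : ℕ} {X Y : SchemeOver k} (hX : IsSmoothProjective n X)
    (hXv : HasGoodReductionAt X n v) (hY : IsSmoothProjective m Y) (hYv : HasGoodReductionAt Y m v)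
    (f : X ⟶ Y) (i : ℕ) {x : L ⊗[k] D.obj X i}
    (hx : x ∈ LinearMap.range ((D.pullback f i).baseChange L)) :
    Φ.phi X i x ∈ LinearMap.range ((D.pullback f i).baseChange L) := by
  obtain ⟨y, rfl⟩ := hx
  exact ⟨Φ.phi Y i y, (Φ.phi_pullback hX hXv hY hYv f i y).symm⟩

/-- Iterated naturality of the linear Frobenius: `φ_X^M ∘ (f^* ⊗ L) = (f^* ⊗ L) ∘ φ_Y^M`. [cite: BerthelotOgus1983, Thm. 4.2] -/
theorem phi_pow_pullback {n m : ℕ} {X Y : SchemeOver k} (hX : IsSmoothProjective n X)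
    (hXv : HasGoodReductionAt X n v) (hY : IsSmoothProjective m Y) (hYv : HasGoodReductionAt Y m v)
    (f : X ⟶ Y) (i : ℕ) (M : ℕ) (y : L ⊗[k] D.obj Y i) :
    ((Φ.phi X i) ^ M) ((D.pullback f i).baseChange L y) =
      (D.pullback f i).baseChange L (((Φ.phi Y i) ^ M) y) := by
  induction M generalizing y with
  | zero => simp
  | succ M ih =>
      rw [pow_succ, Module.End.mul_apply, Φ.phi_pullback hX hXv hY hYv f i y, ih, pow_succ,
        Module.End.mul_apply]

/-- **Pivot transfer.** Let `f : X ⟶ Y` and `f' : X' ⟶ Y` be two `k`-morphisms into the same smooth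
projective `Y` (two fibres of one connected family inside the compactified total space) whose pull-backs kill
the same classes (`ker (f^* ⊗ L) = ker (f'^* ⊗ L)`). If `φ_v^N = c · id` on all of `H^i_dR(X') ⊗ L` (a PIVOT
fibre: e.g. supersingular or Fermat reduction at `v`), then `φ_v^N = c · id` on the fixed part
`im (f^* ⊗ L)` at `X`: the class `φ_Y^N y - c y` dies on the pivot fibre, hence on every fibre. [cite: BerthelotOgus1983, Thm. 4.2] -/
theorem pivot_transfer {n n' m : ℕ} {X X' Y : SchemeOver k} (hX : IsSmoothProjective n X)
    (hXv : HasGoodReductionAt X n v) (hX' : IsSmoothProjective n' X')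
    (hX'v : HasGoodReductionAt X' n' v) (hY : IsSmoothProjective m Y)
    (hYv : HasGoodReductionAt Y m v) (f : X ⟶ Y) (f' : X' ⟶ Y) (i : ℕ)
    (hker : LinearMap.ker ((D.pullback f i).baseChange L) =
      LinearMap.ker ((D.pullback f' i).baseChange L))
    (c : L) (N : ℕ) (hpiv : ∀ y : L ⊗[k] D.obj X' i, ((Φ.phi X' i) ^ N) y = c • y)
    {x : L ⊗[k] D.obj X i} (hx : x ∈ LinearMap.range ((D.pullback f i).baseChange L)) :
    ((Φ.phi X i) ^ N) x = c • x := by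
  obtain ⟨y, rfl⟩ := hx
  set w : L ⊗[k] D.obj Y i := ((Φ.phi Y i) ^ N) y - c • y with hw
  have hw' : (D.pullback f' i).baseChange L w = 0 := by
    rw [hw, map_sub, LinearMap.map_smul, ← phi_pow_pullback Φ hX' hX'v hY hYv f' i N y, hpiv,
      sub_self]
  have hwf : (D.pullback f i).baseChange L w = 0 := by
    have : w ∈ LinearMap.ker ((D.pullback f' i).baseChange L) := hw'
    rw [← hker] at this
    exact this
  rw [hw, map_sub, LinearMap.map_smul, sub_eq_zero] at hwf
  rw [phi_pow_pullback Φ hX hXv hY hYv f i N y, hwf]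

/-- Algebraic classes are Tate on the nose under every power of `φ_v`: `φ_v^N (1 ⊗ x) = (q_v^r)^N (1 ⊗ x)`
for `x ∈ Alg^r(X)` (from the datum's `phi_tmul_of_mem_algebraicClasses`) — so a frame statement for a fixed
part `I ⊆ Alg^r(X) + k·α` is exactly about the one new line `k·α`. [cite: Ogus1982, §4 (4.1.2)] -/
theorem phi_pow_tmul_of_mem_algebraicClasses {n : ℕ} {X : SchemeOver k} (hX : IsSmoothProjective n X)
    (hXv : HasGoodReductionAt X n v) (r N : ℕ) {x : D.obj X (2 * r)}
    (hx : x ∈ D.algebraicClasses X r) :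
    ((Φ.phi X (2 * r)) ^ N) ((1 : L) ⊗ₜ[k] x) =
      (((v.residueCard : L) ^ r) ^ N) • ((1 : L) ⊗ₜ[k] x) := by
  induction N with
  | zero => simp
  | succ N ih =>
      rw [pow_succ', Module.End.mul_apply, ih, LinearMap.map_smul,
        Φ.phi_tmul_of_mem_algebraicClasses hX hXv r hx, smul_smul, ← pow_succ]

end NumberField

/-! ## §2 Model / semilinear form (`CrystallineRealization`) -/

section Models

variable {p : ℕ} [Fact p.Prime] {k : Type} [Field k] [CharP k p] [PerfectRing k p]
  (C : CrystallineRealization p k)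

/-- **Relative seeds carry fixed-part Chern characters.** For a morphism of `W(k)`-schemes `h : 𝒳 ⟶ 𝒴`
(intended: fibre over a `W`-point of the Hodge locus ↪ compactified total space) and a vector bundle `E` on the
special fibre of the TOTAL space `𝒴`, the Berthelot–Ogus image of `ch_r^cris(E|_{X_k})` lies in the de Rham
image `im(h_K^* : H²ʳ_dR(Y_K) → H²ʳ_dR(X_K))`, i.e. in the de Rham fixed part (`pullback_chCris` +
`bo_naturality`). Adapted from `IdeatorTwoSketch.lean`. [cite: BerthelotOgus1983, (2.4.5)] -/
theorem bo_chCris_pullback_mem_range {𝒳 𝒴 : SchemeOver (WittVector p k)} (h : 𝒳 ⟶ 𝒴)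
    (E : (WittScheme.specialFibre 𝒴).left.Modules) (hE : IsVectorBundle E) (r : ℕ) :
    C.bo 𝒳 (2 * r)
        (C.chCris (WittScheme.specialFibre 𝒳)
          ((Scheme.Modules.pullback
            ((baseChangeHom (WittVector.constantCoeff : WittVector p k →+* k)).map h).left).obj E) r)
      ∈ LinearMap.range (C.dR.pullback ((baseChange (WittVector p k) K(p, k)).map h) (2 * r)) := by
  refine ⟨C.bo 𝒴 (2 * r) (C.chCris (WittScheme.specialFibre 𝒴) E r), ?_⟩
  rw [← C.bo_naturality h (2 * r)]
  congr 1
  exact C.pullback_chCris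
    ((baseChangeHom (WittVector.constantCoeff : WittVector p k →+* k)).map h) E hE r

/-- **The crystalline fixed part is `φ`-stable**: the image of `(h mod p)^* : Hⁱ(Y_k) → Hⁱ(X_k)` is stable
under the semilinear Frobenius `φ` of `X_k` (`frobK_pullback`) — the model-wise twin of
`range_pullback_phi_stable`. Adapted from `IdeatorTwoSketch.lean`. [cite: BerthelotOgus1983, Thm. 4.2] -/
theorem frobK_mem_range_pullback {𝒳 𝒴 : SchemeOver (WittVector p k)} (h : 𝒳 ⟶ 𝒴) (i : ℕ)
    {x : C.obj (WittScheme.specialFibre 𝒳) i}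
    (hx : x ∈ LinearMap.range
      (C.pullback ((baseChangeHom (WittVector.constantCoeff : WittVector p k →+* k)).map h) i)) :
    C.frobK (WittScheme.specialFibre 𝒳) i x ∈ LinearMap.range
      (C.pullback ((baseChangeHom (WittVector.constantCoeff : WittVector p k →+* k)).map h) i) := by
  obtain ⟨y, rfl⟩ := hx
  exact ⟨C.frobK _ i y, (C.frobK_pullback _ i y).symm⟩

/-- **The `K`-span of the Tate classes is `φ`-stable**: `φ (Σ λᵢ tᵢ) = Σ σ(λᵢ) pʳ tᵢ` for Tate classes
`tᵢ` (`φ tᵢ = pʳ tᵢ`) — so the conclusion of a frame statement ("fixed part ⊆ K · Tate") is compatible with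
the `φ`-stability of the fixed part (`frobK_mem_range_pullback`). [cite: Ogus1982, §4 (4.1.2)] -/
theorem frobK_mem_span_tateClasses {X : SchemeOver k} (r : ℕ) {x : C.obj X (2 * r)}
    (hx : x ∈ Submodule.span K(p, k) (C.tateClasses X r : Set (C.obj X (2 * r)))) :
    C.frobK X (2 * r) x ∈ Submodule.span K(p, k) (C.tateClasses X r : Set (C.obj X (2 * r))) := by
  induction hx using Submodule.span_induction with
  | mem t ht =>
      have ht' : C.frobK X (2 * r) t = ((p : K(p, k)) ^ r) • t := ht
      rw [ht']
      exact Submodule.smul_mem _ _ (Submodule.subset_span ht)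
  | zero => simp
  | add x y _ _ hx hy =>
      rw [map_add]
      exact Submodule.add_mem _ hx hy
  | smul a x _ hx =>
      rw [LinearEquiv.map_smulₛₗ]
      exact Submodule.smul_mem _ _ hx

/-! ## §3 Frame-to-engine glue -/

/-- **FRAME + (TATE ⇒ ALGEBRAIC) ⇒ THE FIXED PART IS ALGEBRAIC** (the glue by which the card's frame statement
replaces the route's P4). Let `h : 𝒳 ⟶ 𝒴` be a morphism of `W(k)`-schemes with `𝒴` a smooth proper model (so
that its Berthelot–Ogus map is surjective, `bijective_bo`), and fix `r`. Assume
(FRAME) the crystalline fixed part `im((h mod p)^*) ⊆ H²ʳ(X_k)` lies in the `K`-span of the Tate classes of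
`X_k`, and (TATE ⇒ ALG) every Tate class of `X_k` has Berthelot–Ogus image in the `K`-span of the rational
algebraic classes of `X_K` (the class-by-class output of seeds + engine at this model). Then every de Rham
fixed-part class `α ∈ im(h_K^* : H²ʳ_dR(Y_K) → H²ʳ_dR(X_K))` is a `K`-combination of algebraic classes of `X_K`:
write `α = h_K^* β`, `β = bo_𝒴 y`; by naturality `α = bo_𝒳 ((h mod p)^* y)` with `(h mod p)^* y` in the
fixed part, hence in `K · Tate`, and `bo_𝒳` is `K`-linear. No Tateness of `α` itself is used. [cite: BerthelotOgus1983, (2.4.5) and Cor. 2.5] -/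
theorem bo_mem_span_ratAlgebraicClasses_of_frame {m : ℕ} {𝒳 𝒴 : SchemeOver (WittVector p k)}
    (h : 𝒳 ⟶ 𝒴) (h𝒴 : WittScheme.IsSmoothProperModel m 𝒴) (r : ℕ)
    (hframe : LinearMap.range
        (C.pullback ((baseChangeHom (WittVector.constantCoeff : WittVector p k →+* k)).map h) (2 * r)) ≤
      Submodule.span K(p, k)
        (C.tateClasses (WittScheme.specialFibre 𝒳) r : Set (C.obj (WittScheme.specialFibre 𝒳) (2 * r))))
    (htate : ∀ t ∈ C.tateClasses (WittScheme.specialFibre 𝒳) r,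
      C.bo 𝒳 (2 * r) t ∈ Submodule.span K(p, k)
        (C.dR.ratAlgebraicClasses (WittScheme.genericFibre 𝒳) r :
          Set (C.dR.obj (WittScheme.genericFibre 𝒳) (2 * r))))
    {α : C.dR.obj (WittScheme.genericFibre 𝒳) (2 * r)}
    (hα : α ∈ LinearMap.range (C.dR.pullback ((baseChange (WittVector p k) K(p, k)).map h) (2 * r))) :
    α ∈ Submodule.span K(p, k)
      (C.dR.ratAlgebraicClasses (WittScheme.genericFibre 𝒳) r :
        Set (C.dR.obj (WittScheme.genericFibre 𝒳) (2 * r))) := by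
  obtain ⟨β, rfl⟩ := hα
  obtain ⟨y, rfl⟩ := (C.bijective_bo h𝒴 (2 * r)).2 β
  rw [← C.bo_naturality h (2 * r) y]
  have hx : C.pullback ((baseChangeHom (WittVector.constantCoeff : WittVector p k →+* k)).map h) (2 * r) y
      ∈ Submodule.span K(p, k)
        (C.tateClasses (WittScheme.specialFibre 𝒳) r :
          Set (C.obj (WittScheme.specialFibre 𝒳) (2 * r))) :=
    hframe ⟨y, rfl⟩
  have hle : Submodule.span K(p, k)
        (C.tateClasses (WittScheme.specialFibre 𝒳) r :
          Set (C.obj (WittScheme.specialFibre 𝒳) (2 * r))) ≤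
      (Submodule.span K(p, k)
        (C.dR.ratAlgebraicClasses (WittScheme.genericFibre 𝒳) r :
          Set (C.dR.obj (WittScheme.genericFibre 𝒳) (2 * r)))).comap (C.bo 𝒳 (2 * r)) :=
    Submodule.span_le.2 fun t ht => htate t ht
  exact hle hx

/-- **P4 is the special case "frame of rank one on the nose".** If `α ∈ H²ʳ_dR(X_K/K)` is crystalline Tate at
the smooth proper model `𝒳` (`C.IsTateAtModel 𝒳 r α`: its `bo`-preimage satisfies `φ x = pʳ x`, the route's
typed P4 vocabulary) and every Tate class of `X_k` has algebraic Berthelot–Ogus image on `X_K`, then `α` is a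
`K`-combination of algebraic classes. [cite: Ogus1982, §4 (4.1.2)] -/
theorem mem_span_ratAlgebraicClasses_of_isTateAtModel {n : ℕ} {𝒳 : SchemeOver (WittVector p k)}
    (h𝒳 : WittScheme.IsSmoothProperModel n 𝒳) (r : ℕ)
    (htate : ∀ t ∈ C.tateClasses (WittScheme.specialFibre 𝒳) r,
      C.bo 𝒳 (2 * r) t ∈ Submodule.span K(p, k)
        (C.dR.ratAlgebraicClasses (WittScheme.genericFibre 𝒳) r :
          Set (C.dR.obj (WittScheme.genericFibre 𝒳) (2 * r))))
    {α : C.dR.obj (WittScheme.genericFibre 𝒳) (2 * r)} (hα : C.IsTateAtModel 𝒳 r α) :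
    α ∈ Submodule.span K(p, k)
      (C.dR.ratAlgebraicClasses (WittScheme.genericFibre 𝒳) r :
        Set (C.dR.obj (WittScheme.genericFibre 𝒳) (2 * r))) := by
  obtain ⟨x, rfl⟩ := (C.bijective_bo h𝒳 (2 * r)).2 α
  exact htate x (hα x rfl)

open Summit.HodgeConjecture.HodgeConjecture.Cruxes.HodgeAbelianVarieties.InnerFormInvariantSeeds.Engine in
/-- **FRAME + (⋆)-SEEDS FOR THE TATE CLASSES + ENGINE ⇒ THE FIXED PART IS ALGEBRAIC** (the variational half of
the card's transfer at ONE model, composed with the route's landed engine). On a model `𝒳/W(k)` satisfying the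
hypotheses of the route's crux P1a (smooth proper of relative dimension `d`, projective over `W`, `d + 6 < p`,
`H^b(𝒪)` and `H^b(Ω¹)` `p`-torsion-free, `Ω¹` free or `d ≤ 3`), mapping by `h` to a smooth proper `𝒴` (the
compactified total space), assume (FRAME) as above and (SEEDS) every Tate class `t` of `X_k` in degree `2r`
has a non-zero multiple in the subgroup generated by the crystalline Chern characters `ch_r(E)` of finite
locally free `E` on `X_k` satisfying the Bloch–Esnault–Kerz Hodge condition at `𝒳` and (⋆)
class-lifts-imply-object-lifts. Then — granted the route items P1a `FormalLiftingFromClassLifting`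
(stmt-13825) and P3a `FormalVectorBundlesAlgebraize` (stmt-14106) and the tree's predicate
`BlochEsnaultKerzLifting C`, all taken BY NAME (so this lemma is conditional on them by design) — every de
Rham fixed-part class `α ∈ im(h_K^*)` in degree `2r` is a `K`-combination of algebraic classes of `X_K`
(`…StarSeedsEngine.bo_mem_span_of_starSeedClasses` feeds `bo_mem_span_ratAlgebraicClasses_of_frame`).
[cite: BlochEsnaultKerz2014pAdic, Thm. 1.3] -/
theorem bo_mem_span_ratAlgebraicClasses_of_frame_of_starSeeds
    (hP1a : Summit.HodgeConjecture.HodgeConjecture.Theses.PadicSemiregularLift.FormalLiftingFromClassLifting)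
    (hP3a : Summit.HodgeConjecture.HodgeConjecture.Theses.PadicSemiregularLift.FormalVectorBundlesAlgebraize)
    (hBEK : BlochEsnaultKerzLifting C) {d m : ℕ} {𝒳 𝒴 : SchemeOver (WittVector p k)} (h : 𝒳 ⟶ 𝒴)
    (h𝒳 : WittScheme.IsSmoothProperModel d 𝒳) (h𝒴 : WittScheme.IsSmoothProperModel m 𝒴)
    (hproj : IsProjectiveOverRing 𝒳) (hp : d + 6 < p)
    (hO : ∀ (b : ℕ) (x : structureSheafCohomology 𝒳.left b), (p : ℤ) • x = 0 → x = 0)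
    (hΩ : ∀ (b : ℕ) (x : hodgeCohomologyOne 𝒳 b), (p : ℤ) • x = 0 → x = 0)
    (hfree : d ≤ 3 ∨ Nonempty (cotangentSheaf 𝒳 ≅ SheafOfModules.free (R := 𝒳.left.ringCatSheaf) (Fin d)))
    (r : ℕ)
    (hframe : LinearMap.range
        (C.pullback ((baseChangeHom (WittVector.constantCoeff : WittVector p k →+* k)).map h) (2 * r)) ≤
      Submodule.span K(p, k)
        (C.tateClasses (WittScheme.specialFibre 𝒳) r : Set (C.obj (WittScheme.specialFibre 𝒳) (2 * r))))
    (hseeds : ∀ t ∈ C.tateClasses (WittScheme.specialFibre 𝒳) r, ∃ N : ℤ, N ≠ 0 ∧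
      N • t ∈ AddSubgroup.closure
        {x | ∃ (E : (WittScheme.specialFibre 𝒳).left.Modules) (_ : IsFiniteLocallyFree E),
          C.HodgeCondition 𝒳 E ∧
          (∀ (n : ℕ) (F : (WittScheme.thickening 𝒳 (n + 1)).left.Modules) (hF : IsFiniteLocallyFree F),
            Nonempty ((Scheme.Modules.pullback (WittScheme.specialFibreToThickening 𝒳 n)).obj F ≅ E) →
            (∃ y : KZero (WittScheme.thickening 𝒳 (n + 2)).left,
                KZero.map (WittScheme.thickeningMap 𝒳 (Nat.le_succ (n + 1))) y = KZero.of F hF) →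
            ∃ F' : (WittScheme.thickening 𝒳 (n + 2)).left.Modules, IsFiniteLocallyFree F' ∧
              Nonempty ((Scheme.Modules.pullback
                (WittScheme.thickeningMap 𝒳 (Nat.le_succ (n + 1)))).obj F' ≅ F)) ∧
          x = C.chCris (WittScheme.specialFibre 𝒳) E r})
    {α : C.dR.obj (WittScheme.genericFibre 𝒳) (2 * r)}
    (hα : α ∈ LinearMap.range (C.dR.pullback ((baseChange (WittVector p k) K(p, k)).map h) (2 * r))) :
    α ∈ Submodule.span K(p, k)
      (C.dR.ratAlgebraicClasses (WittScheme.genericFibre 𝒳) r :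
        Set (C.dR.obj (WittScheme.genericFibre 𝒳) (2 * r))) := by
  refine bo_mem_span_ratAlgebraicClasses_of_frame C h h𝒴 r hframe (fun t ht => ?_) hα
  obtain ⟨N, hN, hNt⟩ := hseeds t ht
  exact bo_mem_span_of_starSeedClasses hP1a hP3a C hBEK h𝒳 hproj hp hO hΩ hfree hN hNt

end Models

end Summit.HodgeConjecture.HodgeConjecture.Theorems.HodgeBeyondAnchors.FixedPartFrame

end
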